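import Mathlib.Analysis.InnerProductSpace.Dual
import Mathlib.Tactic.Module
import HarnessLib

/-!
# The axis Christoffel form of a tube with relatively parallel frame (linear algebra)

Topic `Geometry/Riemannian`. Abstract linear algebra behind the Christoffel symbols of the tube
metric around a curve on its axis (Weinstein 1968, proof of the main theorem, step (2); Lee 2018,
Prop. 5.26 (d)). Data: a real inner product space `V` with a unit vector `ε₀` (the model of the
tube), a normed space `T` with a bilinear form `gT` (the tangent space of the ambient manifold at
a point of the curve with its metric), an isometric frame `e : V →L T`
(`gT (e u) (e w) = ⟪u, w⟫`), and the second-order data `A : V → V → T` of the tube map on the axis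
(`A z u = D_z(dΦ u)`, `CurveTubeSecondOrder.lean`): symmetric, linear in the second slot, with
`A ε₀ ε₀ = acc` (the acceleration of the curve), `A ε₀ u = -gT(e u, acc) e ε₀` for `u ⊥ ε₀`
(relatively parallel frame) and `A u u' = 0` for `u, u' ⊥ ε₀` (normal chart of the fibre). The
vector `B z u ∈ V` defined by Riesz, `⟪B z u, w⟫ = gT (A z u) (e w)`, is then the Christoffel map
of the pulled-back metric on the axis (`ChristoffelOfDerivative.christoffel_eq_of_fderiv_eq`), and
this file computes it:

* `rieszOfForm_symm`, `rieszOfForm_add_right`, `rieszOfForm_smul_right`, `rieszOfForm_eq_zero` —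
  Riesz bookkeeping (`⟪B z u, w⟫ = gT (A z u) (e w)` is Mathlib's `InnerProductSpace.toDual_symm_apply`);
* `rieszOfForm_unit_of_inner_eq_zero` — `B ε₀ u = -⟪κ, u⟫ ε₀` for `u ⊥ ε₀`, `κ = B ε₀ ε₀`;
* `rieszOfForm_self_eq` — **`B X X = ⟪ε₀, X⟫² κ - 2 ⟪ε₀, X⟫ ⟪κ, X - ⟪ε₀, X⟫ε₀⟫ ε₀`**, the axis
  Christoffel form of `AxisChristoffelEllipsoidBound.lean`, with `⟪ε₀, κ⟫ = gT acc (e ε₀)`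
  (`inner_unit_rieszOfForm_unit_unit`; `= g(D_t c', c') = 0` for a unit-speed curve).

## References

* A. Weinstein, Ann. of Math. (2) 87 (1968), 29–41, proof of the main theorem, step (2).
  [cite: Weinstein1968]
* J. M. Lee, *Introduction to Riemannian Manifolds*, 2nd ed. (2018), Prop. 5.26 (d).
  [cite: LeeRiemannianManifolds2018, Prop. 5.26]

Tags: [ChristoffelSymbols] [FermiCoordinates] [Weinstein1968]
-/

noncomputable section

open scoped RealInnerProductSpace
open InnerProductSpace

namespace Literature.Geometry.Riemannian

variable {V : Type*} [NormedAddCommGroup V] [InnerProductSpace ℝ V] [CompleteSpace V]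
  {T : Type*} [NormedAddCommGroup T] [NormedSpace ℝ T]
  (gT : T →L[ℝ] T →L[ℝ] ℝ) (e : V →L[ℝ] T) (A : V → V → T)

omit [CompleteSpace V] in
/-- Extensionality through the inner product. [folklore] -/
theorem eq_of_forall_inner_eq {a b : V} (h : ∀ w : V, ⟪a, w⟫ = ⟪b, w⟫) : a = b := by
  have h' : ∀ w : V, ⟪a - b, w⟫ = 0 := fun w ↦ by rw [inner_sub_left, h w, sub_self]
  exact sub_eq_zero.1 (inner_self_eq_zero.1 (h' (a - b)))

/-- Symmetry of `A` gives symmetry of `B`. [folklore] -/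
theorem rieszOfForm_symm (hA : ∀ z u, A z u = A u z) (z u : V) :
    (toDual ℝ V).symm ((gT (A z u)).comp e) = (toDual ℝ V).symm ((gT (A u z)).comp e) := by
  rw [hA]

/-- Additivity of `B` in the second slot from additivity of `A`. [folklore] -/
theorem rieszOfForm_add_right {z u u' : V} (hadd : A z (u + u') = A z u + A z u') :
    (toDual ℝ V).symm ((gT (A z (u + u'))).comp e) =
      (toDual ℝ V).symm ((gT (A z u)).comp e) + (toDual ℝ V).symm ((gT (A z u')).comp e) := by
  rw [← map_add]
  congr 1
  ext w
  show gT (A z (u + u')) (e w) = gT (A z u) (e w) + gT (A z u') (e w)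
  rw [hadd, map_add]
  rfl

/-- Homogeneity of `B` in the second slot from homogeneity of `A`. [folklore] -/
theorem rieszOfForm_smul_right {z u : V} {t : ℝ} (hsmul : A z (t • u) = t • A z u) :
    (toDual ℝ V).symm ((gT (A z (t • u))).comp e) =
      t • (toDual ℝ V).symm ((gT (A z u)).comp e) := by
  rw [← map_smul]
  congr 1
  ext w
  show gT (A z (t • u)) (e w) = t * gT (A z u) (e w)
  rw [hsmul, map_smul]
  rfl

/-- `A z u = 0` gives `B z u = 0`. [folklore] -/
theorem rieszOfForm_eq_zero {z u : V} (h0 : A z u = 0) :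
    (toDual ℝ V).symm ((gT (A z u)).comp e) = 0 := by
  apply eq_of_forall_inner_eq
  intro w
  rw [toDual_symm_apply, ContinuousLinearMap.comp_apply, h0, map_zero, inner_zero_left]
  rfl

/-- **`⟪ε₀, κ⟫ = gT acc (e ε₀)`** for `κ = B ε₀ ε₀`, `A ε₀ ε₀ = acc` (for a unit-speed curve,
`gT acc (e ε₀) = g(D_t c', c') = 0`). [folklore] -/
theorem inner_unit_rieszOfForm_unit_unit {ε₀ : V} {acc : T} (hacc : A ε₀ ε₀ = acc) :
    ⟪ε₀, (toDual ℝ V).symm ((gT (A ε₀ ε₀)).comp e)⟫ = gT acc (e ε₀) := by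
  rw [real_inner_comm, toDual_symm_apply, ContinuousLinearMap.comp_apply, hacc]

/-- **`B ε₀ u = -⟪κ, u⟫ ε₀` for `u ⊥ ε₀`** (relatively parallel frame:
`A ε₀ u = -gT(e u, acc) e ε₀`; isometry of `e`; symmetry of `gT`), with `κ = B ε₀ ε₀`.
[cite: Weinstein1968, proof of the main theorem, step (2)] -/
theorem rieszOfForm_unit_of_inner_eq_zero {ε₀ : V} {acc : T}
    (hgsymm : ∀ a b : T, gT a b = gT b a) (hiso : ∀ u w : V, gT (e u) (e w) = ⟪u, w⟫)
    (hacc : A ε₀ ε₀ = acc) (hpar : ∀ u : V, ⟪ε₀, u⟫ = 0 → A ε₀ u = -(gT (e u) acc) • e ε₀)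
    {u : V} (hu : ⟪ε₀, u⟫ = 0) :
    (toDual ℝ V).symm ((gT (A ε₀ u)).comp e) =
      -⟪(toDual ℝ V).symm ((gT (A ε₀ ε₀)).comp e), u⟫ • ε₀ := by
  apply eq_of_forall_inner_eq
  intro w
  rw [toDual_symm_apply, ContinuousLinearMap.comp_apply, hpar u hu, real_inner_smul_left,
    toDual_symm_apply, ContinuousLinearMap.comp_apply, hacc, hgsymm acc (e u)]
  have h1 : gT ((-(gT (e u) acc)) • e ε₀) (e w) = (-(gT (e u) acc)) * gT (e ε₀) (e w) := by
    rw [map_smul]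
    rfl
  rw [h1, hiso]

/-- **The axis Christoffel form**: under the hypotheses above (`A` symmetric and linear in its
second slot, `A ε₀ ε₀ = acc`, `A ε₀ u = -gT(e u, acc) e ε₀` and `A u u' = 0` for `u, u' ⊥ ε₀`),
`B X X = ⟪ε₀, X⟫² κ - (2 ⟪ε₀, X⟫ ⟪κ, X - ⟪ε₀, X⟫ ε₀⟫) ε₀` with `κ = B ε₀ ε₀`.
[cite: Weinstein1968, proof of the main theorem, step (2)] -/
theorem rieszOfForm_self_eq {ε₀ : V} (hε₀ : ‖ε₀‖ = 1) {acc : T}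
    (hgsymm : ∀ a b : T, gT a b = gT b a) (hiso : ∀ u w : V, gT (e u) (e w) = ⟪u, w⟫)
    (hAsymm : ∀ z u, A z u = A u z) (hAadd : ∀ z u u', A z (u + u') = A z u + A z u')
    (hAsmul : ∀ z u (t : ℝ), A z (t • u) = t • A z u)
    (hacc : A ε₀ ε₀ = acc) (hpar : ∀ u : V, ⟪ε₀, u⟫ = 0 → A ε₀ u = -(gT (e u) acc) • e ε₀)
    (hnn : ∀ u u' : V, ⟪ε₀, u⟫ = 0 → ⟪ε₀, u'⟫ = 0 → A u u' = 0) (X : V) :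
    (toDual ℝ V).symm ((gT (A X X)).comp e) =
      ⟪ε₀, X⟫ ^ 2 • (toDual ℝ V).symm ((gT (A ε₀ ε₀)).comp e) -
        (2 * ⟪ε₀, X⟫ * ⟪(toDual ℝ V).symm ((gT (A ε₀ ε₀)).comp e), X - ⟪ε₀, X⟫ • ε₀⟫) • ε₀ := by
  -- notation
  set B : V → V → V := fun z u ↦ (toDual ℝ V).symm ((gT (A z u)).comp e) with hB
  set X₁ : ℝ := ⟪ε₀, X⟫ with hX₁
  set X' : V := X - X₁ • ε₀ with hX'
  have hee : ⟪ε₀, ε₀⟫ = 1 := by rw [real_inner_self_eq_norm_sq, hε₀, one_pow]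
  have hX'perp : ⟪ε₀, X'⟫ = 0 := by
    rw [hX', inner_sub_right, inner_smul_right, hee, mul_one, sub_self]
  have hXdec : X = X₁ • ε₀ + X' := by rw [hX']; abel
  -- bilinearity of `B`: in the second slot from `A`, in the first slot by symmetry
  have hBsymm : ∀ z u, B z u = B u z := fun z u ↦ rieszOfForm_symm gT e A hAsymm z u
  have hBadd : ∀ z u u', B z (u + u') = B z u + B z u' := fun z u u' ↦
    rieszOfForm_add_right gT e A (hAadd z u u')
  have hBsmul : ∀ z u (t : ℝ), B z (t • u) = t • B z u := fun z u t ↦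
    rieszOfForm_smul_right gT e A (hAsmul z u t)
  have hBadd' : ∀ z z' u, B (z + z') u = B z u + B z' u := fun z z' u ↦ by
    rw [hBsymm, hBadd, hBsymm u z, hBsymm u z']
  have hBsmul' : ∀ z u (t : ℝ), B (t • z) u = t • B z u := fun z u t ↦ by
    rw [hBsymm, hBsmul, hBsymm u z]
  -- the special values
  have hBnn : B X' X' = 0 := rieszOfForm_eq_zero gT e A (hnn X' X' hX'perp hX'perp)
  have hB0u : B ε₀ X' = -⟪B ε₀ ε₀, X'⟫ • ε₀ :=
    rieszOfForm_unit_of_inner_eq_zero gT e A hgsymm hiso hacc hpar hX'perp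
  have hBu0 : B X' ε₀ = -⟪B ε₀ ε₀, X'⟫ • ε₀ := by rw [hBsymm]; exact hB0u
  -- expand `B X X`
  show B X X = X₁ ^ 2 • B ε₀ ε₀ - (2 * X₁ * ⟪B ε₀ ε₀, X'⟫) • ε₀
  conv_lhs => rw [hXdec]
  rw [hBadd, hBadd', hBadd', hBsmul, hBsmul', hBsmul', hBsmul, hBnn, hB0u, hBu0]
  module

end Literature.Geometry.Riemannian

end
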